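/-
Copyright (c) 2026 the pub-hodgecm-mathlib formalisation cell (harness21).  Prover seat hodgecm-mathlib-B-p14 (g37), 2026-09-01.  Road «S3-tree» ∕ residue «S3-res» (architect A-p16 (g30)
A-179 release → LEAD F0P3a-plan (g12); F0P3a-p06 (g15) census «S3-res RECON» §3 (E2), §5 (a)(ii)), brick T1e «VALENCIES», FILE R6: THE TAME-RAMIFIED-PLACE DRESS of ★ R4 ∕ ★ R5d.
-/
import Literature.NumberTheory.Rogawski1990.UnitaryVertexStabilizerSpanSelfDualTameRamifiedCM   -- ★ (F2) F0P3a-p07 (g11): `ramifiedBlock_adicCompletion (he) (h2)` (`ϖ`, `σ_w ϖ = −ϖ`, `hres`, `hnorm`)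
import Literature.NumberTheory.Automorphic.UnitaryLatticeTreeFramesOfInvolution              -- ★ T1 R5d (this seat): `isTree_latticeGraph_three_of_neg`, `ncard_sphere_of_neg`; brings ★ R4 `ncard_neighborSet_of_ramified`
import Literature.NumberTheory.Automorphic.UnitaryGroupIntegralPointsReductionRamified        -- ★ `natCard_residueField_eq_of_ramified` (`|𝓀_w| = q_v`, `f(w|v) = 1`), ★ `natCard_residueField_valuativeRel_eq`
import Literature.NumberTheory.Automorphic.UnitaryGroupInertPlaceHyperbolicBasis              -- ★ `galAdicCompletionMap_galAdicCompletionMap_of_smul_eq` (`σ_w² = 1`)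
import Literature.RingTheory.DiscreteValuationRing.AdicCompletionResidueField                 -- ★ `natCard_residueField_adicCompletion` (`|𝓀[L_w]| = |𝓞_L ∕ 𝔭_w|`), `Finite 𝓀[L_w]`
import HarnessLib

/-!
# The lattice graph of a hermitian space — T1e FILE R6: AT A TAMELY RAMIFIED NON-SPLIT PLACE `w ∣ v` OF A CM FIELD THE `U(3)` LATTICE GRAPH OF `(L_w³, J₀)` IS A
# `(q_v + 1)`-REGULAR TREE — the binders `hσ hvσ hϖ hσϖ hres h2 hnorm`, `|𝓀| = q` of ★ R4 ∕ ★ R5d DISCHARGED (Bruhat–Tits 1972 §10; Tits 1979 §2.4; Serre, *Local Fields* II §4)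

Topic `NumberTheory/Rogawski1990`; namespace `Literature.NumberTheory.Rogawski1990`.  THEOREMS ONLY (no definition, no instance, no notation, no named fact, no `sorry`); kernel
lane.  Cell `pub/hodgecm-mathlib` (D-0151), crux H413 = `stmt-HodgeConjecture-24833`; road «S3-tree», residue «S3-res» = {`v` tame-ramified} ∪ {`v ∣ 2`} ∪ … (architect A-p16 (g30)
A-179; census F0P3a-p06 (g15) «S3-res RECON» §3 (E2): every COUNT of the future tame-ramified column cites the regular tree first).  ★ R4 `UnitaryLatticeTreeValencyRamified`
(p846361) and ★ R5d `UnitaryLatticeTreeFramesOfInvolution` (p846481) prove, over an abstract `K` with `Valued K ℤᵐ⁰` and an isometric involution `σ` with an ANTI-FIXED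
uniformiser `σϖ = −ϖ`, residual triviality `hres`, `|2| = 1` and the first-order norm surjectivity `hnorm`, that the lattice graph `latticeGraph σ ϖ J₀` of `(K³, J₀)` is a TREE,
`(q+1)`-REGULAR (`q = |𝓀[K]|`, both vertex types special), with spheres `#S_m = (q+1)·q^{m−1}`.  HERE these binders are DISCHARGED at a TAMELY RAMIFIED non-split place of a
CM field: `K = L_w := w.1.adicCompletion L`, `σ = σ_w := galAdicCompletionMap complexConj hw`, `v` a finite place of `L⁺` with `w ∣ v`, `complexConj • w = w`, `e(w|v) ≠ 1` (`he`)
and `|2|_w = 1` (`h2`, tame): ★ `ramifiedBlock_adicCompletion (he) (h2)` (F0P3a-p07 (g11)) supplies `hres`, `hnorm` (and one anti-fixed uniformiser), ★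
`galAdicCompletionMap_galAdicCompletionMap_of_smul_eq` ∕ ★ `valued_galAdicCompletionMap` supply `hσ`, `hvσ`, and `|𝓀[L_w]| = |𝓞_L ∕ 𝔭_w| = q_v := |𝓞_{L⁺} ∕ 𝔭_v|`
(★ `natCard_residueField_adicCompletion`, ★ `natCard_residueField_eq_of_ramified`: `f(w|v) = 1`) — in the `Valued` presentation `𝒪[L_w] = Valued.integer`,
`𝓀[L_w] = Valued.ResidueField` that ★ T1a `UnitaryLatticeTreeDefs` lives in.  The heads hold for EVERY uniformiser `ϖ` with `σ_w ϖ = −ϖ` (★ (R1)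
`exists_uniformizer_galAdicCompletionMap_complexConj_eq_neg_of_ramified` provides one); the mirror of ★ V5 `UnitaryLatticeTreeValencyInertPlace` (inert: `(q³+1, q+1)`-bi-regular).

* §1 `natCard_valuedResidueField_eq_of_ramified_CM` (`|𝓀[L_w]| = q_v`).
* §2 THE TAME-RAMIFIED-PLACE HEADS: **`isTree_latticeGraph_three_tameRamifiedCM`**, `finite_neighborSet_tameRamifiedCM`, **`ncard_neighborSet_tameRamifiedCM`** (`q_v + 1` at EVERY
  vertex), **`ncard_sphere_tameRamifiedCM`** (`(q_v+1)·q_v^{m−1}`), `ncard_sphere_two_tameRamifiedCM` (`q_v² + q_v`).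

HONEST LABEL: HC_CM is proved only modulo the 2 remaining named inputs (hLiu418 24832, h413 24833) until rung 0 closes; nothing printed is asserted here; «S3-res» stays print
(the tame-ramified column is capital, not a row).

## References
* [BruhatTits1972] F. Bruhat, J. Tits, *Groupes réductifs sur un corps local I*, Publ. Math. IHÉS 41 (1972), §10 (the building of a rank-one group is a tree).
* [Tits1979] J. Tits, *Reductive groups over local fields*, PSPM 33.1 (1979), §2.4 (ramified quasi-split `U(3)`: local index `(q+1, q+1)`, both vertices special).
* [Serre1980Trees] J.-P. Serre, *Trees* (1980), Ch. I §2.3, Ch. II §1.1 (spheres of a regular tree).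
* [Serre1979] J.-P. Serre, *Local Fields* (1979), Ch. II §4 Prop. 7, Ch. V §3 (tamely ramified quadratic extensions: anti-fixed uniformiser, trivial residual action, norms of one-units).
* [NeukirchANT1999] J. Neukirch, *Algebraic Number Theory* (1999), Ch. I §8 Prop. (8.2), Ch. II §4 Prop. (4.3) (`f(w|v) = 1` at a ramified place of a quadratic extension).
-/

set_option autoImplicit false

noncomputable section

open scoped Valued WithZero Matrix MatrixGroups

namespace Literature.NumberTheory.Rogawski1990

open NumberField IsDedekindDomain
open Literature.NumberTheory.Automorphic Literature.NumberTheory.Automorphic.UnitaryGroup Literature.NumberTheory.Automorphic.HermitianLattice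
open Literature.NumberTheory.Automorphic.UnitaryLatticeTree

variable (L : Type) [Field L] [NumberField L] [IsCMField L] (v : HeightOneSpectrum (𝓞 ↥(maximalRealSubfield L)))
  (w : PlacesOver L v) (hw : IsCMField.complexConj L • w.1 = w.1)

/-! ## §1 The residue field of `L_w` at a ramified non-split place has `q_v` elements (`Valued` presentation) -/

include hw in
/-- **`|𝓀[L_w]| = q_v` at a ramified non-split place** (`Valued` presentation `𝓀[L_w] = ResidueField (w.adicCompletionIntegers L)`; `f(w|v) = 1`).
[cite: NeukirchANT1999, Ch. I §8 Prop. (8.2) and Ch. II §4 Prop. (4.3)] -/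
theorem natCard_valuedResidueField_eq_of_ramified_CM (he : v.asIdeal.ramificationIdx' w.1.asIdeal ≠ 1) :
    Nat.card 𝓀[w.1.adicCompletion L] = Nat.card (𝓞 ↥(maximalRealSubfield L) ⧸ v.asIdeal) := by
  rw [IsDedekindDomain.HeightOneSpectrum.natCard_residueField_adicCompletion L w.1, ← natCard_residueField_valuativeRel_eq (K := L) (v := w.1)]
  exact natCard_residueField_eq_of_ramified (IsCMField.complexConj L) v (IsCMField.complexConj_ne_one L) w hw he

/-! ## §2 The tame-ramified-place heads: the `U(3)` lattice graph of `(L_w³, J₀)` is a `(q_v + 1)`-regular tree -/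

/-- **THE `U(3)` LATTICE GRAPH OF `(L_w³, J₀)` AT A TAMELY RAMIFIED NON-SPLIT PLACE IS A TREE** — for every uniformiser `ϖ` with `σ_w ϖ = −ϖ`; hypotheses `e(w|v) ≠ 1`, `|2|_w = 1`
only (★ R5d `isTree_latticeGraph_three_of_neg` fed by ★ `ramifiedBlock_adicCompletion`). [cite: BruhatTits1972, §10] [cite: Tits1979, §2.4] [cite: Serre1979, Ch. V §3] -/
theorem isTree_latticeGraph_three_tameRamifiedCM (he : v.asIdeal.ramificationIdx' w.1.asIdeal ≠ 1) (h2 : Valued.v (2 : w.1.adicCompletion L) = 1)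
    {ϖ : w.1.adicCompletion L} (hϖ : Valued.v ϖ = WithZero.exp (-1 : ℤ)) (hσϖ : galAdicCompletionMap (L := L) (IsCMField.complexConj L) hw ϖ = -ϖ) :
    (latticeGraph (galAdicCompletionMap (L := L) (IsCMField.complexConj L) hw) ϖ ((StdForm.antidiagonal 3).over (w.1.adicCompletion L))).IsTree := by
  obtain ⟨-, -, -, hres, hnorm⟩ := ramifiedBlock_adicCompletion L v w hw he h2
  exact isTree_latticeGraph_three_of_neg (fun x => galAdicCompletionMap_galAdicCompletionMap_of_smul_eq (IsCMField.complexConj L) w (IsCMField.complexConj_ne_one L) hw x)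
    (fun a => valued_galAdicCompletionMap (L := L) (IsCMField.complexConj L) hw a) hϖ hσϖ hres h2 hnorm

/-- **Every star of the lattice graph of `(L_w³, J₀)` at a tamely ramified non-split place is finite.** [cite: BruhatTits1972, §10] -/
theorem finite_neighborSet_tameRamifiedCM (he : v.asIdeal.ramificationIdx' w.1.asIdeal ≠ 1) (h2 : Valued.v (2 : w.1.adicCompletion L) = 1)
    {ϖ : w.1.adicCompletion L} (hϖ : Valued.v ϖ = WithZero.exp (-1 : ℤ)) (hσϖ : galAdicCompletionMap (L := L) (IsCMField.complexConj L) hw ϖ = -ϖ)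
    (x : {M : Submodule 𝒪[w.1.adicCompletion L] (Fin 3 → w.1.adicCompletion L) //
      IsVertex (galAdicCompletionMap (L := L) (IsCMField.complexConj L) hw) ϖ ((StdForm.antidiagonal 3).over (w.1.adicCompletion L)) M}) :
    ((latticeGraph (galAdicCompletionMap (L := L) (IsCMField.complexConj L) hw) ϖ ((StdForm.antidiagonal 3).over (w.1.adicCompletion L))).neighborSet x).Finite := by
  obtain ⟨-, -, -, hres, hnorm⟩ := ramifiedBlock_adicCompletion L v w hw he h2
  exact finite_neighborSet_of_ramified (fun y => galAdicCompletionMap_galAdicCompletionMap_of_smul_eq (IsCMField.complexConj L) w (IsCMField.complexConj_ne_one L) hw y)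
    (fun a => valued_galAdicCompletionMap (L := L) (IsCMField.complexConj L) hw a) hσϖ hϖ hres h2 hnorm x

/-- **THE LATTICE GRAPH AT A TAMELY RAMIFIED NON-SPLIT PLACE IS `(q_v + 1)`-REGULAR**: EVERY vertex (self-dual or of type two — both special) has `q_v + 1` neighbours,
`q_v = |𝓞_{L⁺} ∕ 𝔭_v|` (★ R4 `ncard_neighborSet_of_ramified` + §1). [cite: Tits1979, §2.4] [cite: BruhatTits1972, §10] [cite: Serre1980Trees, II.1.1] -/
theorem ncard_neighborSet_tameRamifiedCM (he : v.asIdeal.ramificationIdx' w.1.asIdeal ≠ 1) (h2 : Valued.v (2 : w.1.adicCompletion L) = 1)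
    {ϖ : w.1.adicCompletion L} (hϖ : Valued.v ϖ = WithZero.exp (-1 : ℤ)) (hσϖ : galAdicCompletionMap (L := L) (IsCMField.complexConj L) hw ϖ = -ϖ)
    (x : {M : Submodule 𝒪[w.1.adicCompletion L] (Fin 3 → w.1.adicCompletion L) //
      IsVertex (galAdicCompletionMap (L := L) (IsCMField.complexConj L) hw) ϖ ((StdForm.antidiagonal 3).over (w.1.adicCompletion L)) M}) :
    ((latticeGraph (galAdicCompletionMap (L := L) (IsCMField.complexConj L) hw) ϖ ((StdForm.antidiagonal 3).over (w.1.adicCompletion L))).neighborSet x).ncard =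
      Nat.card (𝓞 ↥(maximalRealSubfield L) ⧸ v.asIdeal) + 1 := by
  obtain ⟨-, -, -, hres, hnorm⟩ := ramifiedBlock_adicCompletion L v w hw he h2
  rw [← natCard_valuedResidueField_eq_of_ramified_CM L v w hw he]
  exact ncard_neighborSet_of_ramified (fun y => galAdicCompletionMap_galAdicCompletionMap_of_smul_eq (IsCMField.complexConj L) w (IsCMField.complexConj_ne_one L) hw y)
    (fun a => valued_galAdicCompletionMap (L := L) (IsCMField.complexConj L) hw a) hσϖ hϖ hres h2 hnorm x

/-- **THE SPHERES OF THE TAME-RAMIFIED TREE**: for EVERY vertex `x` and `m ≥ 1`, `#{y | dist(x, y) = m} = (q_v + 1) · q_v^{m−1}` (★ R5d `ncard_sphere_of_neg` + §1).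
[cite: Serre1980Trees, I.2.3] [cite: Serre1980Trees, II.1.1] [cite: Tits1979, §2.4] -/
theorem ncard_sphere_tameRamifiedCM (he : v.asIdeal.ramificationIdx' w.1.asIdeal ≠ 1) (h2 : Valued.v (2 : w.1.adicCompletion L) = 1)
    {ϖ : w.1.adicCompletion L} (hϖ : Valued.v ϖ = WithZero.exp (-1 : ℤ)) (hσϖ : galAdicCompletionMap (L := L) (IsCMField.complexConj L) hw ϖ = -ϖ)
    (x : {M : Submodule 𝒪[w.1.adicCompletion L] (Fin 3 → w.1.adicCompletion L) //
      IsVertex (galAdicCompletionMap (L := L) (IsCMField.complexConj L) hw) ϖ ((StdForm.antidiagonal 3).over (w.1.adicCompletion L)) M}) {m : ℕ} (hm : 1 ≤ m) :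
    {y | (latticeGraph (galAdicCompletionMap (L := L) (IsCMField.complexConj L) hw) ϖ ((StdForm.antidiagonal 3).over (w.1.adicCompletion L))).dist x y = m}.ncard =
      (Nat.card (𝓞 ↥(maximalRealSubfield L) ⧸ v.asIdeal) + 1) * Nat.card (𝓞 ↥(maximalRealSubfield L) ⧸ v.asIdeal) ^ (m - 1) := by
  obtain ⟨-, -, -, hres, hnorm⟩ := ramifiedBlock_adicCompletion L v w hw he h2
  rw [← natCard_valuedResidueField_eq_of_ramified_CM L v w hw he]
  exact ncard_sphere_of_neg (fun y => galAdicCompletionMap_galAdicCompletionMap_of_smul_eq (IsCMField.complexConj L) w (IsCMField.complexConj_ne_one L) hw y)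
    (fun a => valued_galAdicCompletionMap (L := L) (IsCMField.complexConj L) hw a) hσϖ hϖ hres h2 hnorm x hm

/-- **`q_v² + q_v` VERTICES AT DISTANCE `2`** from any vertex of the tame-ramified tree of `(L_w³, J₀)`. [cite: Serre1980Trees, I.2.3] [cite: Tits1979, §2.4] -/
theorem ncard_sphere_two_tameRamifiedCM (he : v.asIdeal.ramificationIdx' w.1.asIdeal ≠ 1) (h2 : Valued.v (2 : w.1.adicCompletion L) = 1)
    {ϖ : w.1.adicCompletion L} (hϖ : Valued.v ϖ = WithZero.exp (-1 : ℤ)) (hσϖ : galAdicCompletionMap (L := L) (IsCMField.complexConj L) hw ϖ = -ϖ)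
    (x : {M : Submodule 𝒪[w.1.adicCompletion L] (Fin 3 → w.1.adicCompletion L) //
      IsVertex (galAdicCompletionMap (L := L) (IsCMField.complexConj L) hw) ϖ ((StdForm.antidiagonal 3).over (w.1.adicCompletion L)) M}) :
    {y | (latticeGraph (galAdicCompletionMap (L := L) (IsCMField.complexConj L) hw) ϖ ((StdForm.antidiagonal 3).over (w.1.adicCompletion L))).dist x y = 2}.ncard =
      Nat.card (𝓞 ↥(maximalRealSubfield L) ⧸ v.asIdeal) ^ 2 + Nat.card (𝓞 ↥(maximalRealSubfield L) ⧸ v.asIdeal) := by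
  rw [ncard_sphere_tameRamifiedCM L v w hw he h2 hϖ hσϖ x (by norm_num : 1 ≤ 2)]
  ring

end Literature.NumberTheory.Rogawski1990

end
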